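import Summits.NavierStokesRegularity.NavierStokesRegularity.Theorems.ClockStretchingLawClockLaw
import Summits.NavierStokesRegularity.NavierStokesRegularity.Theorems.ClockStretchingLawClockCeilingStubFrameRigidity
import HarnessLib

/-!
# Route `ClockStretchingLaw`, crux `ClockCeiling` (stmt-NavierStokesRegularity-10570):
# the crux is EQUIVALENT to the route target `NoSingularTypeIModel` (stmt-10569) — typed certificate

Line `registered` of the crux, lead c2 (2026-08-17). The crux `ClockCeiling` says: along every element
`u` of the route's Type-I model class `𝒦_C` (smooth, divergence-free, KNSS-mild ancient field on
`ℝ³ × (−∞,0)` with `‖u‖ ≤ C/√(−t)` and scale-invariant local energies `A, E ≤ C`) the clock amplitude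
`a_u(t) = (−t)^{3/2} ∫ ‖∂ₜu(t,x)‖² e^{−‖x‖²/(4(−t))} dx` is not bounded below on `[−1,0)`.

* `clockCeiling_zoomLimit_eq_zero`, `clockCeiling_of_regularOrigin` — the informal statement's claim
  "at an origin where `u` is bounded this is automatic", PROVED for every single element: if `u ∈ 𝒦_C`
  is bounded on some backward cylinder `Q(0,r)`, then `inf_{[−1,0)} a_u = 0`. Proof: were `a_u ≥ δ > 0`
  on `[−1,0)`, the parabolic zooms `u_j = c_j u(c_j² ·, c_j ·)`, `c_j = 1/(j+1)`, subconverge pointwise to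
  an element `W ∈ 𝒦_C` (`stub_zoomExtraction`, the landed zoom extraction of the `ClockLaw` proof) with
  `a_{u_j}(−1) = a_u(−c_j²) → a_W(−1)` (`stub_clockSlice` (iii)–(iv)); but `u_j → 0` pointwise on the open
  slab because the zooms eventually only see `Q(0,r)`, so `W ≡ 0`, `∂ₜW(−1,·) ≡ 0`, `a_W(−1) = 0 < δ`.
* `clockCeiling_of_noSingularTypeIModel` — hence the route TARGET implies the crux;
  `noSingularTypeIModel_of_clockCeiling` — with the PROVED crux `ClockLaw`
  (`clockStretchingLaw_clockLaw_proof`, item 10571) the crux implies the target (the two lines of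
  `target_of_cruxes`); `stub_clockCeilingIffTarget : ClockCeiling ↔ NoSingularTypeIModel`.
* `frameCeiling_iff_clockCeiling` — the line's residual stub `stub_frameCeiling` (four-frame ceiling) is
  equivalent to the crux, by the landed `stub_frameRigidity` (p149959) and the direction `(c₀,b) = (1,0)`.

Consequence (see `ClockStretchingLawClockCeilingLiouvilleNode.lean`): with the landed node equivalences
`squeezeLiouville_iff_noSingularTypeIModel`, `squeezeLiouville_iff_typeIAncientLiouville`, … the crux
`ClockCeiling` is the Type-I Liouville statement `TypeIAncientLiouville` (stmt-4050) by name.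

## References

* G. Koch, N. Nadirashvili, G. Seregin, V. Šverák, Acta Math. 203 (2009) = arXiv:0709.3599, Lemma 6.1,
  Prop. 4.1. [KochNadirashviliSereginSverak2009]
* D. Albritton, T. Barker, J. Math. Fluid Mech. 21 (2019) = arXiv:1811.00502, §1–3. [AlbrittonBarker2019]
-/

noncomputable section

open MeasureTheory Filter Topology Set Metric Function
open scoped NNReal ENNReal

-- `Summit = Problem` namespace duplication is the tree's layout (CONVENTIONS §1); as in every Theorems file.
set_option linter.dupNamespace false

namespace Summit.NavierStokesRegularity.NavierStokesRegularity.Theorems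

open Literature.Analysis Literature.Analysis.FluidPDE
open Summit.NavierStokesRegularity.NavierStokesRegularity.Theorems.ClockLaw.Birth
open Summit.NavierStokesRegularity.NavierStokesRegularity.Theses.ClockStretchingLaw

/-! ### The zoom limit at a bounded origin is the zero field -/

/-- **Zooming in at a bounded origin flattens the field.** If `‖u‖ ≤ M` on the backward cylinder
`(−r², 0) × B_r(0)` and `c_j → 0⁺`, then the parabolic zooms `c_j • stPull (c_j²) c_j 0 0 u`, i.e.
`(t,x) ↦ c_j u(c_j² t, c_j x)`, tend to `0` at every point of the open slab `t < 0`; so any pointwise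
limit `W` of them vanishes there. [folklore] -/
theorem clockCeiling_zoomLimit_eq_zero
    {u W : ℝ → EuclideanSpace ℝ (Fin 3) → EuclideanSpace ℝ (Fin 3)} {r M : ℝ} (hr : 0 < r)
    (hM : ∀ t ∈ Set.Ioo (-(r ^ 2)) (0 : ℝ), ∀ x ∈ Metric.ball (0 : EuclideanSpace ℝ (Fin 3)) r,
      ‖u t x‖ ≤ M)
    {c : ℕ → ℝ} (hcpos : ∀ j, 0 < c j) (hc0 : Tendsto c atTop (𝓝 0))
    (hpt : ∀ t < 0, ∀ x,
      Tendsto (fun j => (c j • stPull (c j ^ 2) (c j) 0 0 u) t x) atTop (𝓝 (W t x))) :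
    ∀ t < 0, ∀ x, W t x = 0 := by
  intro t ht x
  refine tendsto_nhds_unique (hpt t ht x) ?_
  have h1 : ∀ᶠ j in atTop, c j ^ 2 * (-t) < r ^ 2 := by
    have h : Tendsto (fun j => c j ^ 2 * (-t)) atTop (𝓝 (0 ^ 2 * (-t))) := (hc0.pow 2).mul_const _
    rw [zero_pow two_ne_zero, zero_mul] at h
    exact h.eventually (gt_mem_nhds (by positivity))
  have h2 : ∀ᶠ j in atTop, c j * ‖x‖ < r := by
    have h : Tendsto (fun j => c j * ‖x‖) atTop (𝓝 (0 * ‖x‖)) := hc0.mul_const _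
    rw [zero_mul] at h
    exact h.eventually (gt_mem_nhds hr)
  have hev : ∀ᶠ j in atTop, ‖(c j • stPull (c j ^ 2) (c j) 0 0 u) t x‖ ≤ c j * M := by
    filter_upwards [h1, h2] with j hj1 hj2
    have hval : (c j • stPull (c j ^ 2) (c j) 0 0 u) t x = c j • u (c j ^ 2 * t) (c j • x) := by
      simp only [Pi.smul_apply, stPull_apply, zero_add]
    rw [hval, norm_smul, Real.norm_of_nonneg (hcpos j).le]
    refine mul_le_mul_of_nonneg_left (hM _ ⟨?_, ?_⟩ _ ?_) (hcpos j).le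
    · have : c j ^ 2 * (-t) = -(c j ^ 2 * t) := by ring
      linarith
    · exact mul_neg_of_pos_of_neg (pow_pos (hcpos j) 2) ht
    · rw [Metric.mem_ball, dist_zero_right, norm_smul, Real.norm_of_nonneg (hcpos j).le]
      exact hj2
  have hlim : Tendsto (fun j => c j * M) atTop (𝓝 0) := by
    simpa using hc0.mul_const M
  exact squeeze_zero_norm' hev hlim

/-! ### The ceiling is automatic at a bounded origin -/

/-- **`ClockCeiling` at a bounded origin, for every single element of the class.** If `u ∈ 𝒦_C`
(Type-I KNSS-mild with the scale-invariant energy ledger) is bounded on some backward cylinder at the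
space-time origin, then its clock amplitude is not bounded below on `[−1,0)`: `∀ δ > 0 ∃ t ∈ [−1,0)`,
`a_u(t) < δ`. A floor `a_u ≥ δ` would pass to the zoom limit `W ∈ 𝒦_C` along `c_j = 1/(j+1)`
(`stub_zoomExtraction`, `stub_clockSlice` (iii)–(iv): `a_{u_{c_j}}(−1) = a_u(−c_j²) → a_W(−1)`), while
`W ≡ 0` (`clockCeiling_zoomLimit_eq_zero`) has `a_W(−1) = 0`.
[cite: KochNadirashviliSereginSverak2009, Lemma 6.1 and Prop. 4.1 (arXiv:0709.3599 pp. 8, 11)] -/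
theorem clockCeiling_of_regularOrigin {C : ℝ}
    {u : ℝ → EuclideanSpace ℝ (Fin 3) → EuclideanSpace ℝ (Fin 3)} (hu : IsTypeIAncientMild C u)
    (hE : ∀ (x₀ : EuclideanSpace ℝ (Fin 3)) (t₀ r : ℝ), t₀ ≤ 0 → 0 < r →
      (∀ t, t₀ - r ^ 2 < t → t < t₀ → r⁻¹ * ∫ x in Metric.ball x₀ r, ‖u t x‖ ^ 2 ≤ C) ∧
        r⁻¹ * ∫ t in Set.Ioo (t₀ - r ^ 2) t₀, ∫ x in Metric.ball x₀ r, ‖fderiv ℝ (u t) x‖ ^ 2 ≤ C)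
    (hreg : ¬ (∀ r > 0, ∀ M : ℝ, ∃ t ∈ Set.Ioo (-(r ^ 2)) (0 : ℝ),
      ∃ x ∈ Metric.ball (0 : EuclideanSpace ℝ (Fin 3)) r, M < ‖u t x‖)) :
    ∀ δ > 0, ∃ t : ℝ, -1 ≤ t ∧ t < 0 ∧ (-t) ^ ((3 : ℝ) / 2) *
      ∫ x, ‖timeDeriv u t x‖ ^ 2 * Real.exp (-(‖x‖ ^ 2) / (4 * (-t))) < δ := by
  push Not at hreg
  obtain ⟨r, hr, M, hM⟩ := hreg
  intro δ hδ
  by_contra h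
  push Not at h
  obtain ⟨-, -, hconv, hcov⟩ := stub_clockSlice stub_timeDerivBounds
  -- the scales `c n = 1/(n+1) ∈ (0,1]`, `c n → 0`
  set c : ℕ → ℝ := fun n => 1 / ((n : ℝ) + 1) with hc
  have hcpos : ∀ n, 0 < c n := fun n => Nat.one_div_pos_of_nat
  have hcle : ∀ n, c n ≤ 1 := fun n => by
    have hn : (0 : ℝ) ≤ n := Nat.cast_nonneg n
    rw [hc]
    dsimp only
    rw [div_le_one (by linarith)]
    linarith
  have hc0 : Tendsto c atTop (𝓝 0) := tendsto_one_div_add_atTop_nhds_zero_nat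
  -- zoom extraction: a pointwise limit `W ∈ 𝒦_C` of a subsequence of the zooms
  obtain ⟨φ, hφ, W, hW, -, hpt⟩ := stub_zoomExtraction C u hu hE c hcpos
  -- the limit vanishes on the open slab, so its clock at `s = -1` reads zero
  have hW0 : ∀ t < 0, ∀ x, W t x = 0 :=
    clockCeiling_zoomLimit_eq_zero hr hM (fun j => hcpos (φ j)) (hc0.comp hφ.tendsto_atTop) hpt
  have hTD : ∀ x, timeDeriv W (-1) x = 0 := fun x => by
    rw [timeDeriv_apply]
    have hev : (fun s => W s x) =ᶠ[𝓝 (-1 : ℝ)] fun _ => (0 : EuclideanSpace ℝ (Fin 3)) := by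
      filter_upwards [Iio_mem_nhds (show (-1 : ℝ) < 0 by norm_num)] with s hs using hW0 s hs x
    rw [hev.deriv_eq, deriv_const]
  have haW : (-(-1 : ℝ)) ^ ((3 : ℝ) / 2) *
      ∫ x, ‖timeDeriv W (-1) x‖ ^ 2 * Real.exp (-(‖x‖ ^ 2) / (4 * (-(-1 : ℝ)))) = 0 := by
    simp_rw [hTD, norm_zero]
    simp
  -- the zooms lie in the class; their clocks at `s = -1` converge to the clock of `W`
  have hzoom : ∀ j, IsTypeIAncientMild C (c (φ j) • stPull (c (φ j) ^ 2) (c (φ j)) 0 0 u) :=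
    fun j => isTypeIAncientMild_zoom hu (hcpos (φ j)) 0
  have hlimA := hconv C _ W hzoom hW hpt (-1) (by norm_num)
  -- covariance: `a_{u_c}(-1) = a_u(-c²) ≥ δ` since `-c² ∈ [-1, 0)`
  have hge : ∀ j, δ ≤ (-(-1 : ℝ)) ^ ((3 : ℝ) / 2) *
      ∫ y, ‖timeDeriv (c (φ j) • stPull (c (φ j) ^ 2) (c (φ j)) 0 0 u) (-1) y‖ ^ 2 *
        Real.exp (-(‖y‖ ^ 2) / (4 * (-(-1 : ℝ)))) := by
    intro j
    rw [hcov C u hu (c (φ j)) (hcpos (φ j)) (-1) (by norm_num)]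
    have hsq : c (φ j) ^ 2 ≤ 1 := pow_le_one₀ (hcpos _).le (hcle _)
    have hsq' : 0 < c (φ j) ^ 2 := pow_pos (hcpos _) 2
    exact h _ (by linarith) (by linarith)
  have hle := ge_of_tendsto hlimA (Eventually.of_forall hge)
  rw [haW] at hle
  exact absurd hle (not_le.2 hδ)

/-! ### The crux and the route target are equivalent -/

/-- **Target ⇒ crux.** `NoSingularTypeIModel` (stmt-10569: no element of `𝒦_C` is unbounded in every
backward cylinder at the origin) implies `ClockCeiling`: every element then has a bounded origin, where
the ceiling is automatic (`clockCeiling_of_regularOrigin`).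
[cite: KochNadirashviliSereginSverak2009, Lemma 6.1 and Prop. 4.1 (arXiv:0709.3599 pp. 8, 11)] -/
theorem clockCeiling_of_noSingularTypeIModel (hX : NoSingularTypeIModel) : ClockCeiling := by
  intro C u hu δ hδ
  obtain ⟨h1, h2, h3, h4, hE⟩ := hu
  exact clockCeiling_of_regularOrigin (clockLaw_isTypeIAncientMild_of_inline h1 h2 h3 h4) hE
    (hX C u ⟨h1, h2, h3, h4, hE⟩) δ hδ

/-- **Crux ⇒ target** (the two lines of `target_of_cruxes`, with the PROVED crux `ClockLaw`,
`clockStretchingLaw_clockLaw_proof`, item 10571): on a singular element the clock law gives a floor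
`a_u ≥ δ > 0` on `[−1,0)`, which `ClockCeiling` denies. [folklore] -/
theorem noSingularTypeIModel_of_clockCeiling (hK : ClockCeiling) : NoSingularTypeIModel := by
  intro C u hu hsing
  obtain ⟨δ, hδ, hfloor⟩ := clockStretchingLaw_clockLaw_proof C u hu hsing
  obtain ⟨t, ht1, ht2, hlt⟩ := hK C u hu δ hδ
  exact absurd (hfloor t ht1 ht2) (not_le.2 hlt)

/-- **CERTIFICATE `stub_clockCeilingIffTarget`: the crux `ClockCeiling` (stmt-10570) and the route
target `NoSingularTypeIModel` (stmt-10569) are EQUIVALENT** (given the proved `ClockLaw`). The route's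
split `NoSingularTypeIModel ⇐ ClockCeiling ∧ ClockLaw` therefore has no slack left: its open crux IS its
target. [folklore] -/
theorem stub_clockCeilingIffTarget :
    Summit.NavierStokesRegularity.NavierStokesRegularity.Theses.ClockStretchingLaw.ClockCeiling ↔
      Summit.NavierStokesRegularity.NavierStokesRegularity.Theses.ClockStretchingLaw.NoSingularTypeIModel :=
  ⟨noSingularTypeIModel_of_clockCeiling, clockCeiling_of_noSingularTypeIModel⟩

/-- `ClockCeiling ↔ NoSingularTypeIModel` (short name of the certificate `stub_clockCeilingIffTarget`). [folklore] -/
theorem clockCeiling_iff_noSingularTypeIModel : ClockCeiling ↔ NoSingularTypeIModel :=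
  stub_clockCeilingIffTarget

/-- **The crux is decided on the singular elements alone**: `ClockCeiling` holds iff the ceiling holds
along every element of `𝒦_C` that is SINGULAR at the space-time origin (the regular ones are settled by
`clockCeiling_of_regularOrigin`). [folklore] -/
theorem clockCeiling_iff_singular :
    ClockCeiling ↔
      ∀ (C : ℝ) (u : ℝ → EuclideanSpace ℝ (Fin 3) → EuclideanSpace ℝ (Fin 3)),
        IsTypeIAncientMild C u →
        (∀ (x₀ : EuclideanSpace ℝ (Fin 3)) (t₀ r : ℝ), t₀ ≤ 0 → 0 < r →
          (∀ t, t₀ - r ^ 2 < t → t < t₀ → r⁻¹ * ∫ x in Metric.ball x₀ r, ‖u t x‖ ^ 2 ≤ C) ∧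
            r⁻¹ * ∫ t in Set.Ioo (t₀ - r ^ 2) t₀, ∫ x in Metric.ball x₀ r, ‖fderiv ℝ (u t) x‖ ^ 2 ≤ C) →
        (∀ r > 0, ∀ M : ℝ, ∃ t ∈ Set.Ioo (-(r ^ 2)) (0 : ℝ),
          ∃ x ∈ Metric.ball (0 : EuclideanSpace ℝ (Fin 3)) r, M < ‖u t x‖) →
        ∀ δ > 0, ∃ t : ℝ, -1 ≤ t ∧ t < 0 ∧ (-t) ^ ((3 : ℝ) / 2) *
          ∫ x, ‖timeDeriv u t x‖ ^ 2 * Real.exp (-(‖x‖ ^ 2) / (4 * (-t))) < δ := by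
  constructor
  · intro hK C u hu hE _ δ hδ
    obtain ⟨h1, h2, h3, h4⟩ := (isTypeIAncientMild_iff (C := C) (u := u)).1 hu
    exact hK C u ⟨h1, h2, fun s t hst ht x => by rw [h3 s t hst ht x]; rfl, h4, hE⟩ δ hδ
  · intro hS C u hu δ hδ
    obtain ⟨h1, h2, h3, h4, hE⟩ := hu
    have hu' : IsTypeIAncientMild C u := clockLaw_isTypeIAncientMild_of_inline h1 h2 h3 h4
    by_cases hsing : ∀ r > 0, ∀ M : ℝ, ∃ t ∈ Set.Ioo (-(r ^ 2)) (0 : ℝ),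
        ∃ x ∈ Metric.ball (0 : EuclideanSpace ℝ (Fin 3)) r, M < ‖u t x‖
    · exact hS C u hu' hE hsing δ hδ
    · exact clockCeiling_of_regularOrigin hu' hE hsing δ hδ

/-! ### The line's residual stub is the crux -/

/-- **The four-frame ceiling (stub `stub_frameCeiling` of line `registered`) is EQUIVALENT to the crux.**
(⇒) frame rigidity under a clock floor (the landed `stub_frameRigidity`, p149959) turns a clock floor into
a frame floor, which the frame ceiling denies; (⇐) the direction `(c₀, b) = (1, 0)` of the frame form is
the clock amplitude. Hence the line's only open stub, the crux, and the route target coincide.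
[folklore] -/
theorem frameCeiling_iff_clockCeiling :
    (∀ (C : ℝ) (u : ℝ → EuclideanSpace ℝ (Fin 3) → EuclideanSpace ℝ (Fin 3)), ContDiffOn ℝ (⊤ : ℕ∞) (Function.uncurry u) (Set.Iio 0 ×ˢ Set.univ) ∧ (∀ t < 0, Literature.Analysis.FluidPDE.VectorCalculus.IsDivFree (u t)) ∧ (∀ s t : ℝ, s < t → t < 0 → ∀ x, u t x = Literature.Analysis.FluidPDE.heatFlow (u s) (t - s) x - ∫ τ in Set.Ioo s t, ∫ y, ((-(inner ℝ (x - y) (u τ y) / (2 * (t - τ)) * Literature.Analysis.UnboundedOperators.heatKernel (t - τ) (x - y))) • u τ y + (∫ σ in Set.Ioi (t - τ), Literature.Analysis.UnboundedOperators.heatKernel σ (x - y) / (4 * σ ^ 2)) • (inner ℝ (x - y) (u τ y) • u τ y + inner ℝ (u τ y) (u τ y) • (x - y) + inner ℝ (x - y) (u τ y) • u τ y) - ((∫ σ in Set.Ioi (t - τ), Literature.Analysis.UnboundedOperators.heatKernel σ (x - y) / (8 * σ ^ 3)) * (inner ℝ (x - y) (u τ y) * inner ℝ (x - y) (u τ y)))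 • (x - y))) ∧ Literature.Analysis.FluidPDE.HasTypeITimeDecay C u ∧ (∀ (x₀ : EuclideanSpace ℝ (Fin 3)) (t₀ r : ℝ), t₀ ≤ 0 → 0 < r → (∀ t, t₀ - r ^ 2 < t → t < t₀ → r⁻¹ * ∫ x in Metric.ball x₀ r, ‖u t x‖ ^ 2 ≤ C) ∧ r⁻¹ * ∫ t in Set.Ioo (t₀ - r ^ 2) t₀, ∫ x in Metric.ball x₀ r, ‖fderiv ℝ (u t) x‖ ^ 2 ≤ C) → ∀ η > 0, ∃ t : ℝ, -1 ≤ t ∧ t < 0 ∧ ∃ (c₀ : ℝ) (b : EuclideanSpace ℝ (Fin 3)), c₀ ^ 2 + ‖b‖ ^ 2 = 1 ∧ Real.sqrt (-t) * ∫ x, ‖(c₀ * Real.sqrt (-t)) • Literature.Analysis.FluidPDE.timeDeriv u t x + fderiv ℝ (u t) x b‖ ^ 2 * Real.exp (-(‖x‖ ^ 2) / (4 * (-t))) < η) ↔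
      ClockCeiling := by
  constructor
  · intro hC C u hu δ hδ
    by_contra h
    push Not at h
    obtain ⟨η, hη, hlaw⟩ := stub_frameRigidity C u hu δ hδ h
    obtain ⟨t, ht₁, ht₂, c₀, b, hcb, hlt⟩ := hC C u hu η hη
    exact absurd (hlaw t ht₁ ht₂ c₀ b hcb) (not_le.mpr hlt)
  · intro hK C u hu η hη
    obtain ⟨t, ht₁, ht₂, hlt⟩ := hK C u hu η hη
    refine ⟨t, ht₁, ht₂, 1, 0, by simp, ?_⟩
    have ht : 0 < -t := by linarith
    have e : Real.sqrt (-t) * ∫ x, ‖(1 * Real.sqrt (-t)) • Literature.Analysis.FluidPDE.timeDeriv u t x + fderiv ℝ (u t) x 0‖ ^ 2 * Real.exp (-(‖x‖ ^ 2) / (4 * (-t))) = (-t) ^ ((3 : ℝ) / 2) * ∫ x, ‖Literature.Analysis.FluidPDE.timeDeriv u t x‖ ^ 2 * Real.exp (-(‖x‖ ^ 2) / (4 * (-t))) := by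
      have h1 : ∀ x, ‖(1 * Real.sqrt (-t)) • Literature.Analysis.FluidPDE.timeDeriv u t x + fderiv ℝ (u t) x 0‖ ^ 2 = (-t) * ‖Literature.Analysis.FluidPDE.timeDeriv u t x‖ ^ 2 := fun x => by
        rw [map_zero, add_zero, one_mul, norm_smul, Real.norm_of_nonneg (Real.sqrt_nonneg _), mul_pow, Real.sq_sqrt ht.le]
      simp_rw [h1, mul_assoc]
      rw [MeasureTheory.integral_const_mul, ← mul_assoc]
      congr 1
      rw [Real.sqrt_eq_rpow, ← Real.rpow_add_one ht.ne']
      norm_num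
    rw [e]
    exact hlt

/-- **The residual stub follows from the target** (and conversely implies it through the crux): the
line `registered` is closed by `NoSingularTypeIModel` and by nothing less. [folklore] -/
theorem frameCeiling_iff_noSingularTypeIModel :
    (∀ (C : ℝ) (u : ℝ → EuclideanSpace ℝ (Fin 3) → EuclideanSpace ℝ (Fin 3)), ContDiffOn ℝ (⊤ : ℕ∞) (Function.uncurry u) (Set.Iio 0 ×ˢ Set.univ) ∧ (∀ t < 0, Literature.Analysis.FluidPDE.VectorCalculus.IsDivFree (u t)) ∧ (∀ s t : ℝ, s < t → t < 0 → ∀ x, u t x = Literature.Analysis.FluidPDE.heatFlow (u s) (t - s) x - ∫ τ in Set.Ioo s t, ∫ y, ((-(inner ℝ (x - y) (u τ y) / (2 * (t - τ)) * Literature.Analysis.UnboundedOperators.heatKernel (t - τ) (x - y))) • u τ y + (∫ σ in Set.Ioi (t - τ), Literature.Analysis.UnboundedOperators.heatKernel σ (x - y) / (4 * σ ^ 2)) • (inner ℝ (x - y) (u τ y) • u τ y + inner ℝ (u τ y) (u τ y) • (x - y) + inner ℝ (x - y) (u τ y) • u τ y) - ((∫ σ in Set.Ioi (t - τ), Literature.Analysis.UnboundedOperators.heatKernel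 σ (x - y) / (8 * σ ^ 3)) * (inner ℝ (x - y) (u τ y) * inner ℝ (x - y) (u τ y))) • (x - y))) ∧ Literature.Analysis.FluidPDE.HasTypeITimeDecay C u ∧ (∀ (x₀ : EuclideanSpace ℝ (Fin 3)) (t₀ r : ℝ), t₀ ≤ 0 → 0 < r → (∀ t, t₀ - r ^ 2 < t → t < t₀ → r⁻¹ * ∫ x in Metric.ball x₀ r, ‖u t x‖ ^ 2 ≤ C) ∧ r⁻¹ * ∫ t in Set.Ioo (t₀ - r ^ 2) t₀, ∫ x in Metric.ball x₀ r, ‖fderiv ℝ (u t) x‖ ^ 2 ≤ C) → ∀ η > 0, ∃ t : ℝ, -1 ≤ t ∧ t < 0 ∧ ∃ (c₀ : ℝ) (b : EuclideanSpace ℝ (Fin 3)), c₀ ^ 2 + ‖b‖ ^ 2 = 1 ∧ Real.sqrt (-t) * ∫ x, ‖(c₀ * Real.sqrt (-t)) • Literature.Analysis.FluidPDE.timeDeriv u t x + fderiv ℝ (u t) x b‖ ^ 2 * Real.exp (-(‖x‖ ^ 2) / (4 * (-t))) < η) ↔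
      NoSingularTypeIModel :=
  frameCeiling_iff_clockCeiling.trans clockCeiling_iff_noSingularTypeIModel

end Summit.NavierStokesRegularity.NavierStokesRegularity.Theorems

end
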